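import Summits.ResolutionOfSingularities.ResolutionOfSingularities.Theorems.FrobeniusLadderFRationalResolutionPrimaryCentreAtIsolatedPointFan
import Summits.ResolutionOfSingularities.ResolutionOfSingularities.Theorems.FrobeniusLadderFRationalResolutionKatoIdealLocalizes
import Summits.ResolutionOfSingularities.ResolutionOfSingularities.Theorems.FrobeniusLadderFRationalResolutionEtaleChartPrimaryCentreAlgClosed
import HarnessLib

/-!
# Crux `FrobeniusLadder.FRationalResolution` (stmt-ResolutionOfSingularities-15317), line `redirect`,
# stub `stub_diagonalizableQuotientResolution` — ASSEMBLY (ε₂′): ISOLATED singularities over an algebraically closed field which are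
# étale-locally «fixed points» of log regular charts ARE RESOLVABLE

Scheme-level composition of this generation's bricks: `…PrimaryCentreAtIsolatedPointFan.exists_primary_monomialCentre_of_isolated'` (ε₁′:
the `𝔮`-primary monomial centre with regular blow-up, fan data produced), `LogChart.exists_mul_mem_ideal_of_isLogRegularAt_of_ringKrullDim_eq`
(Kato's ideal localizes to `𝔮` at full dimension) and `…EtaleChartPrimaryCentreAlgClosed.hasResolution_of_isolated_etale_primaryBlowup_of_isAlgClosed`
(E-k over `K = K̄`). The remaining hypotheses are the CHART-SIDE data at the chart point `y` over each singular `x` — exactly what the fixed-point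
analysis of the quotient chart delivers (`…FixedPointLogRegularNhd`, `…FixedPointDimension`, `…ChartNormalization`, `…RegularConeRegularPoint`,
`…SimplicialConePrimSimplicial`): an affine open `V ∋ y` with an fs spanning chart `ψ : P → Γ(Y, V)` log regular at every prime, `ψ(P ∖ 0) ⊆ 𝔮_y`,
`dim Γ(Y,V)_{𝔮_y} = n`, every other prime of `Γ(Y, V)` regular, and the face fan of `P^∨` primitively simplicial and not regular.

* **`hasResolution_of_isolated_logRegular_fixed_charts_of_isAlgClosed`** — THE THEOREM of this file.

What is NOT here (ε₂″, pure chart-side plumbing): producing these data from the stub's `hq` charts at a `D(A)`-fixed point over `x`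
(tame `A`: `…FixedChart`). Honest label: assembly (no stub closed by name). No definitions, no named facts, no sorry.
[cite: Kato1994, Def. (2.1), (10.3), (10.4)] [cite: KempfEtAl1973, Ch. I §2 Thm. 11] [cite: Kollar2007, §2.2]
-/

noncomputable section

-- single-problem summit: the doubled namespace component is forced
set_option linter.dupNamespace false

open CategoryTheory AlgebraicGeometry TopologicalSpace
open Literature.AlgebraicGeometry.Resolution Literature.Geometry.PolyhedralFans
open Literature.AlgebraicGeometry.Resolution.LogBlowup Literature.AlgebraicGeometry.Resolution.LogChart
open Summit.ResolutionOfSingularities.ResolutionOfSingularities.Theorems.FRationalResolution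

namespace Summit.ResolutionOfSingularities.ResolutionOfSingularities.Theorems.FRationalResolution.IsolatedFixedChartResolution

/-- **(ε₂′) Isolated singularities over `K = K̄` that are étale-locally fixed points of log regular charts are resolvable.** Let `X` be an
integral scheme locally of finite type over an algebraically closed field `K` with finitely many singular points. Suppose every singular
point `x` is `φ y` for an étale `φ : Y → X` and a CLOSED point `y` with an affine open `V ∋ y` carrying an fs spanning chart
`ψ : P → Γ(Y, V)` (`P ⊆ ℤⁿ` finitely generated, saturated, spanning), log regular at every prime of `Γ(Y, V)`, with `ψ(P ∖ 0) ⊆ 𝔮_y`,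
`dim Γ(Y, V)_{𝔮_y} = n`, all primes `≠ 𝔮_y` of `Γ(Y, V)` regular, and the face fan of `P^∨` primitively simplicial and not regular. Then `X`
has a resolution of singularities. [cite: Kato1994, (10.4)] [cite: KempfEtAl1973, Ch. I §2 Thm. 11] [cite: Kollar2007, §2.2] -/
theorem hasResolution_of_isolated_logRegular_fixed_charts_of_isAlgClosed (K : Type) [Field K] [IsAlgClosed K]
    (X : Scheme.{0}) [IsIntegral X] (f : X ⟶ Spec (.of K)) [LocallyOfFiniteType f]
    (hfin : (Scheme.regularLocus X)ᶜ.Finite)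
    (hchart : ∀ x : X, x ∉ Scheme.regularLocus X →
      ∃ (Y : Scheme.{0}) (φ : Y ⟶ X) (_ : Etale φ) (y : Y) (_ : φ y = x) (_ : IsClosed ({y} : Set Y))
        (V : Y.Opens) (hV : IsAffineOpen V) (hyV : y ∈ V) (_ : IsNoetherianRing Γ(Y, V))
        (n : ℕ) (P : AddSubmonoid (Fin n → ℤ)) (hP : P.FG)
        (_ : ∀ (v : Fin n → ℤ) (k : ℕ), 0 < k → k • v ∈ P → v ∈ P)
        (hspan : Submodule.span ℤ (P : Set (Fin n → ℤ)) = ⊤)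
        (ψ : Multiplicative P →* Γ(Y, V)),
        (∀ (𝔭 : Ideal Γ(Y, V)) [𝔭.IsPrime], IsLogRegularAt P ψ 𝔭) ∧
        (∀ p : P, (p : Fin n → ℤ) ≠ 0 → ψ (Multiplicative.ofAdd p) ∈ (hV.primeIdealOf ⟨y, hyV⟩).asIdeal) ∧
        ringKrullDim (Localization.AtPrime (hV.primeIdealOf ⟨y, hyV⟩).asIdeal) = n ∧
        (∀ (𝔓 : Ideal Γ(Y, V)) [𝔓.IsPrime], 𝔓 ≠ (hV.primeIdealOf ⟨y, hyV⟩).asIdeal →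
          IsRegularLocalRing (Localization.AtPrime 𝔓)) ∧
        (Fan.ofCone (dualCone P) (dualCone_fg P hP) (isSalient_dualCone P hspan)).IsPrimSimplicial ∧
        ¬ (Fan.ofCone (dualCone P) (dualCone_fg P hP) (isSalient_dualCone P hspan)).IsRegular) :
    Scheme.HasResolution X := by
  classical
  refine EtaleChartPrimaryCentreAlgClosed.hasResolution_of_isolated_etale_primaryBlowup_of_isAlgClosed K X f hfin
    fun x hx => ?_
  obtain ⟨Y, φ, _, y, hyx, hycl, V, hV, hyV, _, n, P, hP, hsat, hspan, ψ, hreg, hfix, hdim, hisol, hps, hnreg⟩ :=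
    hchart x hx
  refine ⟨Y, φ, inferInstance, y, hyx, ?_⟩
  set 𝔮 := hV.primeIdealOf ⟨y, hyV⟩ with h𝔮def
  haveI h𝔮max : 𝔮.asIdeal.IsMaximal := hV.primeIdealOf_isMaximal_of_isClosed ⟨y, hyV⟩ hycl
  -- the Kato ideal localizes to `𝔮`
  have hI𝔮 := exists_mul_mem_ideal_of_isLogRegularAt_of_ringKrullDim_eq (hreg 𝔮.asIdeal) hfix hdim
  -- the `𝔮`-primary monomial centre with regular blow-up
  obtain ⟨s, -, hregJ, hJ𝔮, g, hg𝔮, hpow⟩ :=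
    PrimaryCentreAtIsolatedPointFan.exists_primary_monomialCentre_of_isolated' hP hsat hspan hreg 𝔮.asIdeal hfix hI𝔮
      hisol hps hnreg
  set J := Ideal.span ((fun p : P => ψ (Multiplicative.ofAdd p)) '' (s : Set P)) with hJdef
  -- pass to the basic open `D(g) ∋ y`
  have hyg : y ∈ Y.basicOpen g := by
    letI := Y.presheaf.algebra_section_stalk ⟨y, hyV⟩
    haveI := hV.isLocalization_stalk ⟨y, hyV⟩
    rw [Scheme.mem_basicOpen (hx := hyV)]
    have hng : algebraMap Γ(Y, V) (Y.presheaf.stalk y) g ∉ IsLocalRing.maximalIdeal _ := by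
      rw [IsLocalization.AtPrime.to_map_mem_maximal_iff (Y.presheaf.stalk y) 𝔮.asIdeal]; exact hg𝔮
    exact not_not.1 fun h => hng ((IsLocalRing.mem_maximalIdeal _).2 h)
  have hV' : IsAffineOpen (Y.basicOpen g) := hV.basicOpen g
  haveI hlocg : IsLocalization.Away g Γ(Y, Y.basicOpen g) := hV.isLocalization_basicOpen g
  set 𝔮' := hV'.primeIdealOf ⟨y, hyg⟩ with h𝔮'def
  have hQQ : 𝔮'.asIdeal.comap (algebraMap Γ(Y, V) Γ(Y, Y.basicOpen g)) = 𝔮.asIdeal := by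
    ext t
    letI := Y.presheaf.algebra_section_stalk ⟨y, hyV⟩
    haveI := hV.isLocalization_stalk ⟨y, hyV⟩
    letI := Y.presheaf.algebra_section_stalk (U := Y.basicOpen g) ⟨y, hyg⟩
    haveI := hV'.isLocalization_stalk ⟨y, hyg⟩
    rw [Ideal.mem_comap,
      ← IsLocalization.AtPrime.to_map_mem_maximal_iff (Y.presheaf.stalk y) 𝔮'.asIdeal,
      ← IsLocalization.AtPrime.to_map_mem_maximal_iff (Y.presheaf.stalk y) 𝔮.asIdeal]
    change (Y.presheaf.germ (Y.basicOpen g) y hyg).hom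
        ((Y.presheaf.map (homOfLE (Y.basicOpen_le g)).op).hom t) ∈ _ ↔
      (Y.presheaf.germ V y hyV).hom t ∈ _
    rw [TopCat.Presheaf.germ_res_apply]
  have hQ'eq : 𝔮'.asIdeal = 𝔮.asIdeal.map (algebraMap Γ(Y, V) Γ(Y, Y.basicOpen g)) := by
    rw [← hQQ]
    exact (IsLocalization.map_under (Submonoid.powers g) Γ(Y, Y.basicOpen g) 𝔮'.asIdeal).symm
  obtain ⟨N, hN⟩ := hpow Γ(Y, Y.basicOpen g)
  set J' : Ideal Γ(Y, Y.basicOpen g) := J.map (algebraMap Γ(Y, V) Γ(Y, Y.basicOpen g)) with hJ'def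
  refine ⟨Y.basicOpen g, hV', hyg, J', N, ?_, ?_, ?_⟩
  · rw [hQ'eq]; exact hN
  · rw [hQ'eq]; exact Ideal.map_mono hJ𝔮
  · haveI : IsOpenImmersion (Spec.map (CommRingCat.ofHom (algebraMap Γ(Y, V) Γ(Y, Y.basicOpen g)))) :=
      IsOpenImmersion.of_isLocalization g
    exact BlowupFlatCriteria.isRegular_affineBlowup_map_of_isOpenImmersion _ J hregJ

end Summit.ResolutionOfSingularities.ResolutionOfSingularities.Theorems.FRationalResolution.IsolatedFixedChartResolution

end
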